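import Mathlib
import Summits.QuantumFields.YangMills.Theses.GronwallGap
import Summits.QuantumFields.YangMills.Theorems.PencilRigidityWeakCouplingHypercubicLimitStubRpSpectralOfColdPressure
import Summits.QuantumFields.YangMills.Theorems.PencilRigidityWeakCouplingHypercubicLimitStubVolumeFloorOfPolyVolume
import HarnessLib

/-!
# `ContinuumFromLatticeGap` (stmt-QuantumFields-15915), line `registered` (reshape 4): `stub_rpSpectralOfColdPressure`

Support file for the crux item stmt-QuantumFields-15915 (`GronwallGap.ContinuumFromLatticeGap`), registered stub
`stub_rpSpectralOfColdPressure` of line `registered`, reshape 4 (the wave-1 worker's corrected form of reshape 3's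
`stub_rpSpectral`, which asked: UNIFORM clustering of LOCAL gauge-invariant pairs
along a locked sequence ⇒ the RP-spectral relative clustering of ALL bounded measurable slab functionals `Y` (W₁'s
`RPSpectral` clause, global functional class) with a `k`-uniform thermal error.  reported stub-misstated).  The corrected,
provable-now form registered at reshape 4: the SAME conclusion follows once the cold-pressure bound on the trace excess of the torus
transfer matrix along the scheme is ADDED as a hypothesis — by the landed R6 chain
`rpSpectral_of_coldPressure_scheme` + `stub_volumeFloorOfPolyVolume` (rate `Δ₁/4`, constant `16K`).  The UNIFORM
hypothesis is not used: it constrains only fixed local pairs with pair-dependent constants and never the winding /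
`H²(T³; π₁G)`-flux slab functionals the conclusion quantifies over (cf. the landed negative lemma
`GapAtCorrelationLength_false_of_LightFluxGroup`).  No definitions, no named facts. [folklore]
-/

noncomputable section

namespace Summit.QuantumFields.YangMills.Theorems.ContinuumFromLatticeGap

open scoped SchwartzMap
open Filter Topology MeasureTheory
open Literature.MathematicalPhysics.QuantumFieldTheory Literature.MathematicalPhysics.QuantumLattice
  Literature.MathematicalPhysics.AQFT Literature.Probability.LatticeModels
open Summit.QuantumFields.YangMills.Theorems.WeakCouplingHypercubicLimit.TraceNormColdPressure
open Summit.QuantumFields.YangMills.Cruxes.HypercubicLimit.CouplingResponse (PolyVolume)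

/-- **`stub_rpSpectralOfColdPressure`** (registered stub of line `registered`, reshape 4): the reshape-3
`stub_rpSpectral` signature with ONE extra hypothesis —
the cold-pressure bound `traceExcess r.ρ β_{φ k} (2S+1) (m+2) ≤ C₀ (2S+1)³ e^{−Δ₁ a_k (m+2)}` on the cold tori
`S ≥ L_k`, `S + 1 ≤ 2(m+2)`, eventually in `k`, at some rate `0 < Δ₁ ≤ Δ₀` — after which the conclusion holds with
`Δ := Δ₁/4`, `C := 16K` (`K` the volume floor of the polynomial volumes). [folklore] -/
theorem stub_rpSpectralOfColdPressure :
    ∀ (G : Type) [Group G] [TopologicalSpace G] [IsTopologicalGroup G] [CompactSpace G]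
      [MeasurableSpace G] [BorelSpace G], IsCompactSimpleLieGroup G → ∀ (r : LatticeRep G)
      (β : ℕ → ℝ) (mh : ℕ → ℝ) (S₁ : ℕ → ℕ), Tendsto β atTop atTop → (∀ k, 0 < mh k) →
      (∀ A B : YMSpecies G, ∃ C : ℝ, ∀ k S n : ℕ, S₁ k ≤ S → n ≤ S →
        |latticeConnectedCorr r.ρ (β k) (2 * S + 1) A.F B.F n| ≤ C * Real.exp (-(mh k * n))) →
      ∀ (sch : SpeciesScheme (YMSpecies G)) (φ : ℕ → ℕ) (Δ₀ : ℝ), StrictMono φ → 0 < Δ₀ →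
        (∀ k, sch.β k = β (φ k)) → (∀ k, Δ₀ * sch.a k ≤ mh (φ k)) → (∀ k, S₁ (φ k) ≤ sch.L k) →
        (∃ N : ℕ, 1 ≤ N ∧ ∀ᶠ k in atTop, (sch.a k)⁻¹ ≤ (sch.a k * (sch.L k : ℝ)) ^ N) →
        (∃ C₀ Δ₁ : ℝ, 0 ≤ C₀ ∧ 0 < Δ₁ ∧ Δ₁ ≤ Δ₀ ∧
          ∀ᶠ k in atTop, ∀ S : ℕ, sch.L k ≤ S → ∀ m : ℕ, S + 1 ≤ 2 * (m + 2) →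
            traceExcess r.ρ (sch.β k) (2 * S + 1) (m + 2) ≤
              C₀ * ((2 * S + 1 : ℕ) : ℝ) ^ 3 * Real.exp (-(Δ₁ * sch.a k * ((m + 2 : ℕ) : ℝ)))) →
        ∃ Δ C : ℝ, 0 < Δ ∧ Δ ≤ Δ₀ ∧
          ∀ᶠ k in atTop, ∀ (S₀ T₀ n : ℕ), sch.L k ≤ S₀ → 2 * (T₀ + n + 1) ≤ S₀ →
            ∀ (Y : LGConfig 4 G → ℝ) (B : ℝ), Measurable Y → (∀ U, |Y U| ≤ B) →
              DependsOn Y {e : Literature.MathematicalPhysics.QuantumLattice.ZdEdge 4 |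
                1 ≤ e.1 0 ∧ e.1 0 + (if e.2 = 0 then 1 else 0) ≤ T₀} →
              |(∫ U, Y (torusLift (2 * S₀ + 1) (GaugeConfig.timeReflect U)) *
                    Y (configShift (-Pi.single 0 (n : ℤ)) (torusLift (2 * S₀ + 1) U))
                  ∂(wilsonMeasure r.ρ (sch.β k) : Measure (GaugeConfig 4 (2 * S₀ + 1) G))) -
                (∫ U, Y (torusLift (2 * S₀ + 1) U)
                  ∂(wilsonMeasure r.ρ (sch.β k) : Measure (GaugeConfig 4 (2 * S₀ + 1) G))) ^ 2| ≤
                Real.exp (-(Δ * sch.a k * n)) *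
                  ((∫ U, Y (torusLift (2 * S₀ + 1) (GaugeConfig.timeReflect U)) * Y (torusLift (2 * S₀ + 1) U)
                      ∂(wilsonMeasure r.ρ (sch.β k) : Measure (GaugeConfig 4 (2 * S₀ + 1) G))) -
                    (∫ U, Y (torusLift (2 * S₀ + 1) U)
                      ∂(wilsonMeasure r.ρ (sch.β k) : Measure (GaugeConfig 4 (2 * S₀ + 1) G))) ^ 2) +
                C * B ^ 2 * Real.exp (-(Δ * sch.a k * S₀)) := by
  intro G _ _ _ _ _ _ _ r β mh S₁ hβ _ _ sch φ Δ₀ hφ _ hβφ _ _ hpoly ⟨C₀, Δ₁, hC₀, hΔ₁, hΔ₁₀, hP⟩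
  -- the couplings along the scheme are eventually non-negative
  have hβk : ∀ᶠ k in atTop, 0 ≤ sch.β k := by
    have h : Tendsto (fun k => β (φ k)) atTop atTop := hβ.comp hφ.tendsto_atTop
    filter_upwards [h.eventually_ge_atTop 0] with k hk
    rw [hβφ k]; exact hk
  -- the volume floor from the polynomial volumes
  have hpv : PolyVolume sch := hpoly
  obtain ⟨K, hK⟩ := stub_volumeFloorOfPolyVolume _ sch Δ₁ C₀ hpv hΔ₁ hC₀
  have h := rpSpectral_of_coldPressure_scheme G r _ sch Δ₁ C₀ K hβk hΔ₁ hC₀ hK hP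
  refine ⟨Δ₁ / 4, 16 * K, by positivity, by linarith, ?_⟩
  filter_upwards [h] with k hk S₀ T₀ n hS hgeom Y B hYm hYb hYd
  exact hk S₀ T₀ n hS hgeom Y B hYm hYb hYd

end Summit.QuantumFields.YangMills.Theorems.ContinuumFromLatticeGap

end
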